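import Summits.FinalStateConjecture.FinalStateConjecture.Theorems.EIHFluxBalanceInertialRecessionStaircaseMain

/-!
# Route EIHFluxBalance — crux `InertialRecession` (E′), line `SketchCleanExcision`:
# the staircase, part 7 — the last step and the induction

Helper file for the crux `stmt-FinalStateConjecture-17403`
(`Summit.FinalStateConjecture.FinalStateConjecture.Theses.EIHFluxBalance.InertialRecession`), registered stub
`stub_integratedClusterBalance` (skeleton r12, `Cruxes/InertialRecession/Lines/SketchCleanExcision.lean`).

`staircase_finish` — from the invariant of part 6 at `s₀` with `t₂ ≤ s₀ + σ/4`: a last partial static step and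
the identification at `t₂` give `|kin S t₂ − kin S t₁| ≤ 2N·Z t₁ + B·∫_{t₁}^{t₂} (min (r s) s)^{-3/2}`;
`staircase_bound` — the same conclusion unconditionally, by induction on the number of full steps (each of
length `≥ η = λ·min (c₀t₁) 1/4 > 0`, so finitely many exhaust `[t₁, t₂]`). Mathlib only (plus parts 1–6).
[folklore]
-/

noncomputable section

set_option linter.dupNamespace false

open scoped BigOperators Classical Topology
open Finset Filter MeasureTheory intervalIntegral

namespace Summit.FinalStateConjecture.FinalStateConjecture.Theorems.SublinearIsFree.Staircase

open Literature.Geometry.Lorentzian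


variable {N : ℕ} {M : Fin N → ℝ} {ξ v : Fin N → ℝ → E3} {κ : ℝ} {P : ℝ → E3 → ℝ → Fin 4 → ℝ}
  {T C_W C_E c₀ lam cρ A B : ℝ} {ρ ζ Z : ℝ → ℝ} {S : Finset (Fin N)} {t₁ t₂ : ℝ} {r : ℝ → ℝ}

/-- **FINISH**: a last partial step and the identification at `t₂`. [folklore] -/
theorem staircase_finish
    (hκ : 0 < κ)
    (hκ1 : κ < 1)
    (hT1 : 1 ≤ T)
    (hcone : ∀ i s, T ≤ s → ‖ξ i s‖ ≤ κ ^ 2 * s)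
    (hlip : ∀ i s s', T ≤ s → T ≤ s' → ‖ξ i s - ξ i s'‖ ≤ 2 * |s - s'|)
    (hc₀ : c₀ = (κ - κ ^ 2) / 2)
    (hlam : lam = ((16 : ℝ) ^ (N ^ 2 + 1))⁻¹)
    (hcρ : cρ = lam ^ 2 / 8)
    (hρ : ∀ s, ρ s = cρ * (Finset.fold min (c₀ * s) (fun pp ↦ ‖ξ (Prod.fst pp) s - ξ (Prod.snd pp) s‖) (Finset.offDiag Finset.univ)))
    (hA : A = 2 / (lam * c₀))
    (hB : B = N * max C_W 0 * (A * √A) + 2 * (N * C_E * (2 * A * √A / lam)))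
   
    (hCE : 0 ≤ C_E)
    (hWL : ∀ (t₁ t₂ : ℝ) (c : ℝ → E3) (R : ℝ → ℝ), T ≤ t₁ → t₁ ≤ t₂ →
      (∀ s ∈ Set.Icc t₁ t₂, ∀ s' ∈ Set.Icc t₁ t₂, ‖c s - c s'‖ ≤ 2 * |s - s'| ∧ |R s - R s'| ≤ 2 * |s - s'|) →
      (∀ s ∈ Set.Icc t₁ t₂, ρ s ≤ 1 / 8 * R s ∧ ‖c s‖ + R s ≤ (κ + κ ^ 2) / 2 * s ∧
        ∀ j, ‖ξ j s - c s‖ ≤ (1 - 1 / 8) * R s ∨ (1 + 1 / 8) * R s ≤ ‖ξ j s - c s‖) →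
      ∀ μ : Fin 4, |P t₂ (c t₂) (R t₂) μ - P t₁ (c t₁) (R t₁) μ| ≤ C_W * ∫ s in t₁..t₂, (R s ^ (3 / 2 : ℝ))⁻¹)
    (hID : ∀ (t : ℝ) (c : E3) (R : ℝ) (A : Finset (Fin N)), T ≤ t → ρ t ≤ 1 / 8 * R →
      ‖c‖ + R ≤ (κ + κ ^ 2) / 2 * t →
      (∀ j, ‖ξ j t - c‖ ≤ (1 - 1 / 8) * R ∨ (1 + 1 / 8) * R ≤ ‖ξ j t - c‖) →
      (∀ j, j ∈ A ↔ ‖ξ j t - c‖ ≤ (1 - 1 / 8) * R) →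
      |P t c R 0 - ∑ j ∈ A, M j * (√(1 - ‖v j t‖ ^ 2))⁻¹| ≤ ζ t ∧
      ∀ k : Fin 3, |P t c R k.succ - ∑ j ∈ A, M j * (√(1 - ‖v j t‖ ^ 2))⁻¹ * v j t k| ≤ ζ t)
    (hζ0 : ∀ t, 0 ≤ ζ t)
    (hZ : ∀ t s, T ≤ t → t ≤ s → ζ s ≤ Z t)
    (ht₁ : T ≤ t₁)
    (hr : ∀ s ∈ Set.Icc t₁ t₂, 0 < r s ∧ ∀ i ∈ S, ∀ j ∉ S, r s ≤ ‖ξ i s - ξ j s‖)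
    (hfi : ∀ a b, t₁ ≤ a → a ≤ b → b ≤ t₂ →
      IntervalIntegrable (fun s ↦ ((min (r s) s) ^ (3 / 2 : ℝ))⁻¹) volume a b)
    {s₀ σ : ℝ} (hs₀ : t₁ ≤ s₀) (hs₀t : s₀ ≤ t₂) (hσ : 0 < σ)
    (hgap : ∀ i ∈ S, ∀ j ∈ S, ‖ξ i s₀ - ξ j s₀‖ < σ ∨ 16 * σ ≤ ‖ξ i s₀ - ξ j s₀‖)
    (hσiso : 16 * σ ≤ (Finset.fold min (c₀ * s₀) (fun pp ↦ ‖ξ (Prod.fst pp) s₀ - ξ (Prod.snd pp) s₀‖) (S ×ˢ Sᶜ))) (hlamσ : lam * (Finset.fold min (c₀ * s₀) (fun pp ↦ ‖ξ (Prod.fst pp) s₀ - ξ (Prod.snd pp) s₀‖) (S ×ˢ Sᶜ)) ≤ σ)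
    (hinv : ∀ μ : Fin 4, |∑ p ∈ (Finset.image (fun ii ↦ (dite (Finset.Nonempty (Finset.filter (fun jj ↦ ‖ξ ii s₀ - ξ jj s₀‖ < σ) S)) (fun hh ↦ Finset.min' (Finset.filter (fun jj ↦ ‖ξ ii s₀ - ξ jj s₀‖ < σ) S) hh) (fun _ ↦ ii))) S), P s₀ (ξ p s₀) (4 * σ) μ - (Fin.cons (∑ jj ∈ S, M jj * (√(1 - ‖v jj t₁‖ ^ 2))⁻¹) (fun kk ↦ ∑ jj ∈ S, M jj * (√(1 - ‖v jj t₁‖ ^ 2))⁻¹ * v jj t₁ kk) : Fin 4 → ℝ) μ| ≤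
      N * Z t₁ + B * ∫ s in t₁..s₀, ((min (r s) s) ^ (3 / 2 : ℝ))⁻¹)
    (hlast : t₂ ≤ s₀ + σ / 4) :
    ∀ μ : Fin 4, |(Fin.cons (∑ jj ∈ S, M jj * (√(1 - ‖v jj t₂‖ ^ 2))⁻¹) (fun kk ↦ ∑ jj ∈ S, M jj * (√(1 - ‖v jj t₂‖ ^ 2))⁻¹ * v jj t₂ kk) : Fin 4 → ℝ) μ - (Fin.cons (∑ jj ∈ S, M jj * (√(1 - ‖v jj t₁‖ ^ 2))⁻¹) (fun kk ↦ ∑ jj ∈ S, M jj * (√(1 - ‖v jj t₁‖ ^ 2))⁻¹ * v jj t₁ kk) : Fin 4 → ℝ) μ| ≤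
      2 * N * Z t₁ + B * ∫ s in t₁..t₂, ((min (r s) s) ^ (3 / 2 : ℝ))⁻¹ := by
  have hc := c₀_pos_le hκ hκ1 hc₀
  obtain ⟨hl0, hl1⟩ := lam_pos_le hlam
  have hA1 := one_le_A hlam hA hc
  obtain ⟨hB0, hBW⟩ := B_bounds hκ hκ1 hc₀ hlam hA hB hCE
  have hT0 : 0 ≤ T := by linarith
  have hTs₀ : T ≤ s₀ := ht₁.trans hs₀
  have hcρ0 : 0 ≤ cρ := by rw [hcρ]; positivity
  have hcρ1 : cρ ≤ lam / 4 := by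
    rw [hcρ]
    have : lam ^ 2 ≤ lam := by nlinarith
    linarith
  have hlipS : ∀ s ∈ Set.Icc s₀ t₂, (Finset.fold min (c₀ * s) (fun pp ↦ ‖ξ (Prod.fst pp) s - ξ (Prod.snd pp) s‖) (S ×ˢ Sᶜ)) ≤ (Finset.fold min (c₀ * s₀) (fun pp ↦ ‖ξ (Prod.fst pp) s₀ - ξ (Prod.snd pp) s₀‖) (S ×ˢ Sᶜ)) + 4 * (s - s₀) := fun s hs ↦
    isol_le_isol_add hs.1 (by linarith [hc.2]) fun i ↦ hlip i s₀ s hTs₀ (hTs₀.trans hs.1)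
  have hthr : ∀ s ∈ Set.Icc s₀ t₂, ρ s ≤ 1 / 8 * (4 * σ) := fun s hs ↦
    threshold_main hlip (by linarith [hc.2]) hcρ0 hcρ1 hρ hTs₀ hs.1 (hs.2.trans hlast) hσ hσiso hlamσ
  have hF₀ := fun s (hs : s ∈ Set.Icc s₀ t₂) ↦
    cover_facts (ρ := ρ) hκ hκ1 hT0 hcone hlip hc₀ hTs₀ hs.1 (hs.2.trans hlast) hσ hgap hσiso (hthr s hs)
  obtain ⟨hadm₂, hmem₂, -, -⟩ := hF₀ t₂ ⟨hs₀t, le_rfl⟩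
  -- static cost over the last step and identification at `t₂`
  have hstatic := static_cost hWL hTs₀ hs₀t hσ (card_reps_le (ξ := ξ) (s := s₀) (S := S) (σ := σ))
    (fun s hs p hp ↦ (hF₀ s hs).1 p hp)
  have hid₂ := cover_identification hID (ht₁.trans (hs₀.trans hs₀t)) (hζ0 t₂) hadm₂ hmem₂
  have hZ₂ : (N : ℝ) * ζ t₂ ≤ N * Z t₁ := by gcongr; exact hZ t₁ t₂ ht₁ (hs₀.trans hs₀t)
  -- the step integral
  have hfstep : IntervalIntegrable (fun s ↦ ((min (r s) s) ^ (3 / 2 : ℝ))⁻¹) volume s₀ t₂ :=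
    hfi s₀ t₂ hs₀ hs₀t le_rfl
  have hAσ : 0 < A * σ := by positivity
  have hlow : ∀ s ∈ Set.Icc s₀ t₂, ((A * σ) ^ (3 / 2 : ℝ))⁻¹ ≤ ((min (r s) s) ^ (3 / 2 : ℝ))⁻¹ := fun s hs ↦
    integrand_lower hc.1 hc.2 hl0 hA hσ hs.1 (hs.2.trans hlast) hσiso hlamσ (hlipS s hs)
      (hr s ⟨hs₀.trans hs.1, hs.2⟩).1 (hr s ⟨hs₀.trans hs.1, hs.2⟩).2
  have hJ := integral_lower hs₀t hAσ hfstep hlow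
  have hJ0 : 0 ≤ (t₂ - s₀) * (A * σ * √(A * σ))⁻¹ := by
    have : 0 ≤ t₂ - s₀ := by linarith
    positivity
  have hst' : (t₂ - s₀) * ((4 * σ) ^ (3 / 2 : ℝ))⁻¹ ≤ A * √A * ((t₂ - s₀) * (A * σ * √(A * σ))⁻¹) :=
    static_le_integral hs₀t hA1 hσ
  have hcost : N * max C_W 0 * (t₂ - s₀) * ((4 * σ) ^ (3 / 2 : ℝ))⁻¹ ≤
      B * ∫ s in s₀..t₂, ((min (r s) s) ^ (3 / 2 : ℝ))⁻¹ := by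
    have e1 : N * max C_W 0 * (t₂ - s₀) * ((4 * σ) ^ (3 / 2 : ℝ))⁻¹ ≤
        N * max C_W 0 * (A * √A * ((t₂ - s₀) * (A * σ * √(A * σ))⁻¹)) := by
      rw [mul_assoc (N * max C_W 0 : ℝ)]; exact mul_le_mul_of_nonneg_left hst' (by positivity)
    have e2 : N * max C_W 0 * (A * √A * ((t₂ - s₀) * (A * σ * √(A * σ))⁻¹)) =
        N * max C_W 0 * (A * √A) * ((t₂ - s₀) * (A * σ * √(A * σ))⁻¹) := by ring
    have e3 : N * max C_W 0 * (A * √A) * ((t₂ - s₀) * (A * σ * √(A * σ))⁻¹) ≤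
        B * ((t₂ - s₀) * (A * σ * √(A * σ))⁻¹) := mul_le_mul_of_nonneg_right hBW hJ0
    have e4 : B * ((t₂ - s₀) * (A * σ * √(A * σ))⁻¹) ≤ B * ∫ s in s₀..t₂, ((min (r s) s) ^ (3 / 2 : ℝ))⁻¹ :=
      mul_le_mul_of_nonneg_left hJ hB0
    linarith
  have hadd : ∫ s in t₁..t₂, ((min (r s) s) ^ (3 / 2 : ℝ))⁻¹ =
      (∫ s in t₁..s₀, ((min (r s) s) ^ (3 / 2 : ℝ))⁻¹) + ∫ s in s₀..t₂, ((min (r s) s) ^ (3 / 2 : ℝ))⁻¹ :=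
    (intervalIntegral.integral_add_adjacent_intervals (hfi t₁ s₀ le_rfl hs₀ hs₀t) hfstep).symm
  intro μ
  have h1 := hinv μ
  have h2 := hstatic μ
  have h3 := hid₂ μ
  rw [hadd, mul_add]
  rw [abs_le] at h1 h2 h3 ⊢
  constructor <;> linarith

/-- **THE STAIRCASE BOUND**: `|kin S t₂ − kin S t₁| ≤ 2N·Z t₁ + B·∫_{t₁}^{t₂} (min (r s) s)^{-3/2}` componentwise.
Induction on the number of full steps (each of length `≥ η = λ·min (c₀ t₁) 1 / 4 > 0`). [folklore] -/
theorem staircase_bound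
    (hκ : 0 < κ)
    (hκ1 : κ < 1)
    (hT1 : 1 ≤ T)
    (hcone : ∀ i s, T ≤ s → ‖ξ i s‖ ≤ κ ^ 2 * s)
    (hsep1 : ∀ i j s, i ≠ j → T ≤ s → 1 ≤ ‖ξ i s - ξ j s‖)
    (hlip : ∀ i s s', T ≤ s → T ≤ s' → ‖ξ i s - ξ i s'‖ ≤ 2 * |s - s'|)
    (hc₀ : c₀ = (κ - κ ^ 2) / 2)
    (hlam : lam = ((16 : ℝ) ^ (N ^ 2 + 1))⁻¹)
    (hcρ : cρ = lam ^ 2 / 8)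
    (hρ : ∀ s, ρ s = cρ * (Finset.fold min (c₀ * s) (fun pp ↦ ‖ξ (Prod.fst pp) s - ξ (Prod.snd pp) s‖) (Finset.offDiag Finset.univ)))
    (hA : A = 2 / (lam * c₀))
    (hB : B = N * max C_W 0 * (A * √A) + 2 * (N * C_E * (2 * A * √A / lam)))
   
    (hCE : 0 ≤ C_E)
    (hWL : ∀ (t₁ t₂ : ℝ) (c : ℝ → E3) (R : ℝ → ℝ), T ≤ t₁ → t₁ ≤ t₂ →
      (∀ s ∈ Set.Icc t₁ t₂, ∀ s' ∈ Set.Icc t₁ t₂, ‖c s - c s'‖ ≤ 2 * |s - s'| ∧ |R s - R s'| ≤ 2 * |s - s'|) →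
      (∀ s ∈ Set.Icc t₁ t₂, ρ s ≤ 1 / 8 * R s ∧ ‖c s‖ + R s ≤ (κ + κ ^ 2) / 2 * s ∧
        ∀ j, ‖ξ j s - c s‖ ≤ (1 - 1 / 8) * R s ∨ (1 + 1 / 8) * R s ≤ ‖ξ j s - c s‖) →
      ∀ μ : Fin 4, |P t₂ (c t₂) (R t₂) μ - P t₁ (c t₁) (R t₁) μ| ≤ C_W * ∫ s in t₁..t₂, (R s ^ (3 / 2 : ℝ))⁻¹)
    (hID : ∀ (t : ℝ) (c : E3) (R : ℝ) (A : Finset (Fin N)), T ≤ t → ρ t ≤ 1 / 8 * R →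
      ‖c‖ + R ≤ (κ + κ ^ 2) / 2 * t →
      (∀ j, ‖ξ j t - c‖ ≤ (1 - 1 / 8) * R ∨ (1 + 1 / 8) * R ≤ ‖ξ j t - c‖) →
      (∀ j, j ∈ A ↔ ‖ξ j t - c‖ ≤ (1 - 1 / 8) * R) →
      |P t c R 0 - ∑ j ∈ A, M j * (√(1 - ‖v j t‖ ^ 2))⁻¹| ≤ ζ t ∧
      ∀ k : Fin 3, |P t c R k.succ - ∑ j ∈ A, M j * (√(1 - ‖v j t‖ ^ 2))⁻¹ * v j t k| ≤ ζ t)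
    (hζ0 : ∀ t, 0 ≤ ζ t)
    (hZ : ∀ t s, T ≤ t → t ≤ s → ζ s ≤ Z t)
    (hE : ∀ (t : ℝ) (c : E3) (R Rm : ℝ) (I : Finset (Fin N)) (c' : Fin N → E3) (R' : Fin N → ℝ), T ≤ t → 0 < Rm →
      ρ t ≤ 1 / 8 * Rm → Rm ≤ R → (∀ k ∈ I, Rm ≤ R' k) → ‖c‖ + R ≤ (κ + κ ^ 2) / 2 * t →
      (∀ j, ‖ξ j t - c‖ ≤ (1 - 1 / 8) * R ∨ (1 + 1 / 8) * R ≤ ‖ξ j t - c‖) →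
      (∀ k ∈ I, ∀ j, ‖ξ j t - c' k‖ ≤ (1 - 1 / 8) * R' k ∨ (1 + 1 / 8) * R' k ≤ ‖ξ j t - c' k‖) →
      (∀ k ∈ I, ‖c' k - c‖ + (1 + 1 / 8) * R' k ≤ (1 - 1 / 8) * R) →
      (∀ k ∈ I, ∀ l ∈ I, k ≠ l → (1 + 1 / 8) * (R' k + R' l) ≤ ‖c' k - c' l‖) →
      (∀ j, ‖ξ j t - c‖ ≤ (1 - 1 / 8) * R → ∃ k ∈ I, ‖ξ j t - c' k‖ ≤ (1 - 1 / 8) * R' k) →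
      ∀ μ : Fin 4, |P t c R μ - ∑ k ∈ I, P t (c' k) (R' k) μ| ≤ C_E * (√Rm)⁻¹)
    (ht₁ : T ≤ t₁)
    (h12 : t₁ ≤ t₂)
    (hr : ∀ s ∈ Set.Icc t₁ t₂, 0 < r s ∧ ∀ i ∈ S, ∀ j ∉ S, r s ≤ ‖ξ i s - ξ j s‖)
    (hfi : ∀ a b, t₁ ≤ a → a ≤ b → b ≤ t₂ →
      IntervalIntegrable (fun s ↦ ((min (r s) s) ^ (3 / 2 : ℝ))⁻¹) volume a b) :
    ∀ μ : Fin 4, |(Fin.cons (∑ jj ∈ S, M jj * (√(1 - ‖v jj t₂‖ ^ 2))⁻¹) (fun kk ↦ ∑ jj ∈ S, M jj * (√(1 - ‖v jj t₂‖ ^ 2))⁻¹ * v jj t₂ kk) : Fin 4 → ℝ) μ - (Fin.cons (∑ jj ∈ S, M jj * (√(1 - ‖v jj t₁‖ ^ 2))⁻¹) (fun kk ↦ ∑ jj ∈ S, M jj * (√(1 - ‖v jj t₁‖ ^ 2))⁻¹ * v jj t₁ kk) : Fin 4 → ℝ) μ| ≤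
      2 * N * Z t₁ + B * ∫ s in t₁..t₂, ((min (r s) s) ^ (3 / 2 : ℝ))⁻¹ := by
  have hc := c₀_pos_le hκ hκ1 hc₀
  obtain ⟨hl0, hl1⟩ := lam_pos_le hlam
  -- the uniform step floor
  set η := lam * min (c₀ * t₁) 1 / 4 with hη
  have hη0 : 0 < η := by
    have : 0 < min (c₀ * t₁) 1 := lt_min (mul_pos hc.1 (by linarith)) one_pos
    positivity
  have hfloor : ∀ {s₀ σ : ℝ}, t₁ ≤ s₀ → lam * (Finset.fold min (c₀ * s₀) (fun pp ↦ ‖ξ (Prod.fst pp) s₀ - ξ (Prod.snd pp) s₀‖) (S ×ˢ Sᶜ)) ≤ σ → η ≤ σ / 4 := by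
    intro s₀ σ hs₀ hlamσ
    have := (isol_floor (S := S) hκ hκ1 hT1 hsep1 hc₀ ht₁ hs₀).1
    rw [hη]
    nlinarith [mul_le_mul_of_nonneg_left this hl0.le]
  -- the claim by induction on the number of steps
  have key : ∀ n : ℕ, (∃ s₀ σ : ℝ, t₁ + n * η ≤ s₀ ∧ t₁ ≤ s₀ ∧ s₀ ≤ t₂ ∧ 0 < σ ∧
      (∀ i ∈ S, ∀ j ∈ S, ‖ξ i s₀ - ξ j s₀‖ < σ ∨ 16 * σ ≤ ‖ξ i s₀ - ξ j s₀‖) ∧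
      16 * σ ≤ (Finset.fold min (c₀ * s₀) (fun pp ↦ ‖ξ (Prod.fst pp) s₀ - ξ (Prod.snd pp) s₀‖) (S ×ˢ Sᶜ)) ∧ lam * (Finset.fold min (c₀ * s₀) (fun pp ↦ ‖ξ (Prod.fst pp) s₀ - ξ (Prod.snd pp) s₀‖) (S ×ˢ Sᶜ)) ≤ σ ∧
      ∀ μ : Fin 4, |∑ p ∈ (Finset.image (fun ii ↦ (dite (Finset.Nonempty (Finset.filter (fun jj ↦ ‖ξ ii s₀ - ξ jj s₀‖ < σ) S)) (fun hh ↦ Finset.min' (Finset.filter (fun jj ↦ ‖ξ ii s₀ - ξ jj s₀‖ < σ) S) hh) (fun _ ↦ ii))) S), P s₀ (ξ p s₀) (4 * σ) μ - (Fin.cons (∑ jj ∈ S, M jj * (√(1 - ‖v jj t₁‖ ^ 2))⁻¹) (fun kk ↦ ∑ jj ∈ S, M jj * (√(1 - ‖v jj t₁‖ ^ 2))⁻¹ * v jj t₁ kk) : Fin 4 → ℝ) μ| ≤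
        N * Z t₁ + B * ∫ s in t₁..s₀, ((min (r s) s) ^ (3 / 2 : ℝ))⁻¹) ∨
      ∀ μ : Fin 4, |(Fin.cons (∑ jj ∈ S, M jj * (√(1 - ‖v jj t₂‖ ^ 2))⁻¹) (fun kk ↦ ∑ jj ∈ S, M jj * (√(1 - ‖v jj t₂‖ ^ 2))⁻¹ * v jj t₂ kk) : Fin 4 → ℝ) μ - (Fin.cons (∑ jj ∈ S, M jj * (√(1 - ‖v jj t₁‖ ^ 2))⁻¹) (fun kk ↦ ∑ jj ∈ S, M jj * (√(1 - ‖v jj t₁‖ ^ 2))⁻¹ * v jj t₁ kk) : Fin 4 → ℝ) μ| ≤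
        2 * N * Z t₁ + B * ∫ s in t₁..t₂, ((min (r s) s) ^ (3 / 2 : ℝ))⁻¹ := by
    intro n
    induction n with
    | zero =>
      left
      obtain ⟨σ, hσ, hgap, hσiso, hlamσ, hinv⟩ := staircase_base (S := S) hκ hκ1 hT1 hcone hsep1 hlip hc₀ hlam hcρ hρ hID hζ0 hZ ht₁
      refine ⟨t₁, σ, by simp, le_rfl, h12, hσ, hgap, hσiso, hlamσ, fun μ ↦ ?_⟩
      rw [intervalIntegral.integral_same, mul_zero, add_zero]
      exact hinv μ
    | succ n ih =>
      rcases ih with ⟨s₀, σ, hn, hs₀, hs₀t, hσ, hgap, hσiso, hlamσ, hinv⟩ | hdone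
      · by_cases hlast : t₂ ≤ s₀ + σ / 4
        · right
          exact staircase_finish hκ hκ1 hT1 hcone hlip hc₀ hlam hcρ hρ hA hB hCE hWL hID hζ0 hZ ht₁ hr hfi hs₀ hs₀t hσ hgap hσiso hlamσ hinv hlast
        · left
          push Not at hlast
          obtain ⟨σ₁, hσ₁, hgap₁, hσiso₁, hlamσ₁, hinv₁⟩ :=
            staircase_advance hκ hκ1 hT1 hcone hsep1 hlip hc₀ hlam hcρ hρ hA hB hCE hWL hE ht₁ hr hfi hs₀ hσ hgap hσiso hlamσ hinv hlast.le
          refine ⟨s₀ + σ / 4, σ₁, ?_, by linarith, hlast.le, hσ₁, hgap₁, hσiso₁, hlamσ₁, hinv₁⟩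
          have := hfloor hs₀ hlamσ
          push_cast
          linarith
      · exact Or.inr hdone
  -- enough steps exhaust `[t₁, t₂]`
  obtain ⟨n, hn⟩ := exists_nat_gt ((t₂ - t₁) / η)
  rcases key n with ⟨s₀, σ, hn', -, hs₀t, -⟩ | hdone
  · exfalso
    rw [div_lt_iff₀ hη0] at hn
    linarith
  · exact hdone

/-- Registered one-line form (carrier `staircase_steps_sce12` of the crux item) of the Archimedean step count used by `staircase_bound`. [folklore] -/
theorem staircase_steps_sce12 : ∀ (a b η : ℝ), 0 < η → ∃ n : ℕ, (b - a) / η < n :=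
  fun a b η _ ↦ exists_nat_gt ((b - a) / η)

end Summit.FinalStateConjecture.FinalStateConjecture.Theorems.SublinearIsFree.Staircase

end
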